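import Literature.MathematicalPhysics.QuantumFieldTheory.Balaban1983to89.B5SupWalk125

/-!
# `Balaban1983to89.B5SupWalk131` — Bałaban CMP 95 (1984), Proposition 1.2, STEP S1 AS PRINTED: the conclusion of the
# walk sum (1.131) for a typed sup / Hölder entry DOMINATED by walk-expandable output functionals («we estimate the
# norm ‖ζ∇G∇*J‖_α by the sum of norms», p. 38), with the uniform constants of p. 39

statement-level skeleton of published theorems with citation tags; proofs where landed; nothing here is a claim
about the Yang–Mills mass gap

Source (lit-balaban cell, Phase-2 proof seat p37 gen 8): T. Bałaban, *Propagators and renormalization transformations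
for lattice gauge theories. I*, Commun. Math. Phys. **95** (1984) 17–40 [`Balaban1984PropagatorsI`, "B5"], pp. 36–39
[PDF 20–23]; held as `paper:balaban1984-cmp95-propagators-rt-i`.  Unit `lit-balaban-p37`, HOME
`run/shared/lean/pub/lit-balaban/` (SKELETON rows B5.Prop1.2, B5.Eq1.125, B5.Eq1.130, B5.Eq1.131; owner r02).

v1.1 (docstring-only; declarations byte-identical to v1 p306781), r05 SECOND-READ-B5 pass 17-(b) CITELOC: «We represent G
by the sum in (1.123) … by the sum of norms», «The factors with G are estimated by using (1.115)» and (1.125) are printed on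
p. 38 [PDF 22] ll. 2–5, not on p. 37 — page numerals corrected below.

## WHAT IS PRINTED (verbatim)

p. 38 [PDF 22] ll. 2–3: «We represent G by the sum in (1.123) and we estimate the norm ‖ζ∇G∇*J‖_α by the sum of norms.»
p. 38 [PDF 22], (1.131): «Gathering together all these estimates we obtain
‖ζ∇G∇*J‖_α ≤ O(1)(‖ζ‖_α + |ζ|) Σ_{n=0}^∞ O(1)^{2n}M₀^{−n} Σ_{ω=(ω₀,ω₁,…,ω_n): y∈□_{ω₀}, y′∈□_{ω_n}} e^{−2δ₀|ω₀−ω₁|}·…·e^{−2δ₀|ω_{n−1}−ω_n|}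
(‖J‖_{α+ε} + |J|) ≤ O(1)(‖ζ‖_α + |ζ|)(‖J‖_{α+ε} + |J|) e^{−δ₀|y−y′|} Σ_{n=0}^∞ O(1)^{2n}M₀^{−n}(Σ_{x∈Z^d} e^{−δ₀M₀|x|})ⁿ»;
p. 39 [PDF 23]: «Let us notice that the constant O(1) under the sum above is an absolute constant depending on d only,
hence we can fix M₀ depending on d only, such that the series is convergent. … The proofs of the other inequalities are
exactly the same, but in the estimates of G∇*J we have to take a representation of G adjoint to (1.123), with the
operators K(h) acting on the right.»

## WHAT THIS MODULE PROVES (kernel-checked, zero sorry)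

* `SupConsts` — the uniform `O(1)`'s of pp. 38–39 for the sup/Hölder walk (cube geometry `cbar`, `nu`, `Kbar`; the
  `O(M₀⁻¹)·M₀` of (1.128) as a function `thetaBar` of the (1.126) constants; the relative sizes `cG`, `cF`, `cL`, `c1` of
  the (1.115), (1.125), (1.129), (1.130) constants against the envelope `env` of the (1.115)–(1.117) constants);
* `env` — `1 + |C| + |C_α(α)| + |C_ε(ε)| + |C_ε(ε′)| + |C_{α,ε}(α,ε)|`, the linear envelope of the (1.115)–(1.117)
  constants through which every factor estimate of p. 38 depends on them;
* `Adm` — an ADMISSIBLE OUTPUT FUNCTIONAL `D` of one entry (model: `A ↦ (ζ∇A)(x)` at a point of `Δ̃(y)`, or a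
  Hölder quotient `[(ζ∇A)(x) − (ζ∇A)(x′)]/|x − x′|^α`, or — adjoint representation — `B ↦ ⟨J, ∇B⟩`): it obeys the first
  factor estimate (1.125), is localised at `u`, and obeys the one-factor estimate (1.130) on the given source;
* `Dominated` — a typed quantity `q` (a member of (1.110)–(1.113)) is dominated: its source `src` is localised
  at `u′` and obeys the last-factor estimate (1.129), and `q ≤ B` whenever every admissible `D` has `|D(G src)| ≤ B`;
* **`dominated_le`** — (1.131) ⇒ the printed bound for a dominated quantity:
  `q ≤ (c₁A + c_F A·c_L A/(2γ))·ν·e^{2δ₀c}·(1 − 2γθK)⁻¹·e^{−δ₀ d(u,u′)}·(s₁m₁)` (`B5SupWalk125.SupModel.entry_bound`).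

## HONEST SCOPE

Abstract bookkeeping over `B5SupWalk125.SupModel`; the domination of the typed functionals of `B5.Setting` by
admissible output functionals is the DICTIONARY an instantiation must supply (`B5SupWalkS1.SupRealisation`).  Nothing
here is a torus statement.  CELL BOOK-KEEPING (lit-balaban): rows B5.Eq1.131 / B5.Prop1.2 (step S1, printed currency) —
VALUE = kernel-checked mechanism, NOT summit progress.
-/

namespace Literature.MathematicalPhysics.QuantumFieldTheory.Balaban1983to89.B5SupWalk131

open Finset
open Literature.MathematicalPhysics.QuantumFieldTheory.Balaban1983to89
open Literature.MathematicalPhysics.QuantumFieldTheory.Balaban1983to89.B5SupWalk125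

noncomputable section

/-! ## §1 The uniform constants and the envelope of the (1.115)–(1.117) constants -/

/-- **Uniform constants of the sup/Hölder walk** — p. 39, verbatim: «Let us notice that the constant O(1) under the sum
above is an absolute constant depending on d only, hence we can fix M₀ depending on d only, such that the series is
convergent.»  `cbar` = locality radius of cut-offs / sources / output functionals in units of `M₀`; `nu` = number of
cubes near a point; `Kbar` = the row sum `Σ_{x∈Z^d} e^{−δ₀M₀|x|}` (`δ₀M₀ = ½`); `thetaBar δ′₀ C` = `M₀·O(M₀⁻¹)` of (1.128);
`cG`, `cF`, `cL`, `c1` = the `O(1)`'s of (1.115) (as used for the factors with G), (1.125), (1.129), (1.130) RELATIVE to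
the envelope `env` of the (1.115)–(1.117) constants. [cite: Balaban1984PropagatorsI, pp.38–39] -/
structure SupConsts where
  cbar : ℝ
  nu : ℝ
  Kbar : ℝ
  thetaBar : ℝ → ℝ → ℝ
  cG : ℝ
  cF : ℝ
  cL : ℝ
  c1 : ℝ
  cbar_nonneg : 0 ≤ cbar
  nu_nonneg : 0 ≤ nu
  Kbar_nonneg : 0 ≤ Kbar
  thetaBar_nonneg : ∀ δ C, 0 ≤ thetaBar δ C
  cG_pos : 0 < cG
  cF_nonneg : 0 ≤ cF
  cL_nonneg : 0 ≤ cL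
  c1_nonneg : 0 ≤ c1

/-- the linear ENVELOPE of the (1.115)–(1.117) constants entering one entry: `1 + |C| + |C_α(α)| + |C_ε(ε)| + |C_ε(ε′)| +
|C_{α,ε}(α,ε)|` (the factor estimates (1.125), (1.129), (1.130) depend on them linearly: «The factors with G are
estimated by using (1.115)», p. 38; (1.129) «by using (1.115), (1.116)»; (1.130) «the inequality (1.117) together with
(1.115), (1.116)», p. 38). [cite: Balaban1984PropagatorsI, p.38] -/
def env (C a e e' ae : ℝ) : ℝ := 1 + |C| + |a| + |e| + |e'| + |ae|

/-! ## §2 Admissible output functionals and dominated entries -/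

section Dominate

variable {V Vg : Type} [SeminormedAddCommGroup V] [Module ℝ V] [SeminormedAddCommGroup Vg] [Module ℝ Vg]
  {S X : Type} [Fintype S] [PseudoMetricSpace X]

/-- **ADMISSIBLE OUTPUT FUNCTIONAL of one entry** (model: `D A = (ζ∇A)(x)`, `x ∈ Δ̃(y)`; or the Hölder quotient
`[(ζ∇A)(x) − (ζ∇A)(x′)]/|x−x′|^α`; or, for the adjoint representation of p. 39, `D B = ⟨J, ∇B⟩` on the transposed model),
relative to the operators `G`, `h_z` and the cube geometry (`ctr`, half-width `c`): the FIRST FACTOR estimate (1.125) p. 38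
«‖ζ∇h_zGh_zA‖_α ≤ O(1)(‖ζ‖_α + |ζ|)|h_zA|» with constant `c_F·A·s₁` (`s₁` = the size of the cut, `A` = the envelope of the
(1.115)–(1.117) constants), the same for `D G` (remainder), the LOCALITY of `D` at `u` («y ∈ □_{ω₀}» under the sum of
(1.131)), and the ONE-FACTOR term (1.130) p. 38 «‖ζ∇h_zGh_z∇*J‖_α ≤ O(1)(‖ζ‖_α + |ζ|)(‖J‖_{α+ε} + |J|)» with constant
`c₁·A·s₁·m₁`. [cite: Balaban1984PropagatorsI, (1.125), (1.130)–(1.131) p.38] -/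
def Adm (G : Module.End ℝ V) (H : S → Module.End ℝ V) (ctr : S → X) (c : ℝ) (κ : SupConsts)
    (A s₁ m₁ : ℝ) (u : X) (src : V) (D : V →ₗ[ℝ] ℝ) : Prop :=
  (∀ (z : S) (B : V), ‖D (H z (G B))‖ ≤ κ.cF * A * s₁ * ‖B‖) ∧
  (∀ B : V, ‖D (G B)‖ ≤ κ.cF * A * s₁ * ‖B‖) ∧
  (∀ z : S, ¬ dist u (ctr z) ≤ c → D ∘ₗ H z = 0) ∧
  (∀ z : S, ‖D (H z (G (H z src)))‖ ≤ κ.c1 * A * s₁ * m₁)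

/-- **A typed quantity `q` DOMINATED by the walk** (model: `q` = a member of (1.110)–(1.113), e.g. `‖ζ∇G∇*J‖_α` = the sup
over Hölder quotients `D` of `|D(G∇*J)|`; on a finite torus every such sup is attained, so one extremal `src` / `D`
suffices): sizes `s₁, m₁ ≥ 0` (cut / source, in either order), the source `src` (model: `∇*J`, or `ζ`·dipole in the
adjoint representation) LOCALISED at `u′` («y′ ∈ □_{ω_n}») with the LAST FACTOR estimate
(1.129) p. 38 «|∇Gh_z∇*J| + |Gh_z∇*J| ≤ O(1)(‖J‖_ε + |J|) ≤ O(1)(‖J‖_{α+ε} + |J|)» (constant `c_L·A·m₁`, size map `Dg = ∇`),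
and the dictionary clause: `q ≤ B` as soon as every admissible output functional satisfies `|D(G src)| ≤ B` («we
estimate the norm … by the sum of norms», p. 38). [cite: Balaban1984PropagatorsI, (1.129)–(1.131) p.38] -/
def Dominated (G : Module.End ℝ V) (H : S → Module.End ℝ V) (Dg : V →ₗ[ℝ] Vg) (ctr : S → X) (c : ℝ)
    (κ : SupConsts) (A s₁ m₁ : ℝ) (u u' : X) (src : V) (q : ℝ) : Prop :=
  0 ≤ s₁ ∧ 0 ≤ m₁ ∧
  (∀ z : S, ¬ dist (ctr z) u' ≤ c → H z src = 0) ∧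
  (∀ z : S, size Dg (G (H z src)) ≤ κ.cL * A * m₁) ∧
  (∀ B : ℝ, 0 ≤ B → (∀ D : V →ₗ[ℝ] ℝ, Adm G H ctr c κ A s₁ m₁ u src D → ‖D (G src)‖ ≤ B) → q ≤ B)

/-- **(1.131) FOR A DOMINATED QUANTITY**: in a `SupModel` with row-sum bound `K`, multiplicity `ν` and the smallness
`2γθK < 1` (p. 39 «we can fix M₀ … such that the series is convergent»), a dominated `q` obeys
`q ≤ (c₁A + (c_F A)(c_L A)/(2γ))·ν·e^{2δ₀c}·(1 − 2γθK)⁻¹·e^{−δ₀ d(u,u′)}·(s₁ m₁)` — the second inequality of (1.131) with the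
printed `e^{−δ₀|y−y′|}`, by `B5SupWalk125.SupModel.entry_bound` applied to every admissible output functional.
[cite: Balaban1984PropagatorsI, (1.131) p.38, p.39] -/
theorem dominated_le (M : SupModel V Vg S X) {κ : SupConsts} {K ν : ℝ} (hK : 0 ≤ K)
    (hrow : ∀ a : S, ∑ b : S, Real.exp (-(M.δ₀ * dist (M.ctr a) (M.ctr b))) ≤ K)
    (hν : ∀ x : X, ((Finset.univ.filter fun z : S => dist x (M.ctr z) ≤ M.c).card : ℝ) ≤ ν)
    (hsmall : 2 * M.γ * M.θ * K < 1)
    {A s₁ m₁ : ℝ} (hA : 0 ≤ A) {u u' : X} {src : V} {q : ℝ}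
    (h : Dominated M.G M.H M.Dg M.ctr M.c κ A s₁ m₁ u u' src q) :
    q ≤ (κ.c1 * A + κ.cF * A * (κ.cL * A) / (2 * M.γ)) * ν * Real.exp (2 * M.δ₀ * M.c)
          * (1 - 2 * M.γ * M.θ * K)⁻¹ * Real.exp (-(M.δ₀ * dist u u')) * (s₁ * m₁) := by
  obtain ⟨hs₁, hm₁, hJloc, hL, hdom⟩ := h
  have hγ := M.γ_pos
  have hθ := M.θ_nonneg
  have hν0 : 0 ≤ ν := le_trans (Nat.cast_nonneg _) (hν u)
  have hinv0 : 0 ≤ (1 - 2 * M.γ * M.θ * K)⁻¹ := inv_nonneg.mpr (by linarith)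
  have hcF := κ.cF_nonneg
  have hcL := κ.cL_nonneg
  have hc1 := κ.c1_nonneg
  have hB0 : 0 ≤ (κ.c1 * A + κ.cF * A * (κ.cL * A) / (2 * M.γ)) * ν * Real.exp (2 * M.δ₀ * M.c)
      * (1 - 2 * M.γ * M.θ * K)⁻¹ * Real.exp (-(M.δ₀ * dist u u')) * (s₁ * m₁) := by positivity
  refine hdom _ hB0 fun D hD => ?_
  obtain ⟨hF, hDG, hDloc, hOne⟩ := hD
  have hCF : 0 ≤ κ.cF * A * s₁ := by positivity
  have hCL : 0 ≤ κ.cL * A := by positivity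
  have hC1 : 0 ≤ κ.c1 * A * s₁ := by positivity
  have key := M.entry_bound (W := ℝ) hK hrow hν hsmall hCF hCL hC1 hm₁ (y := u) (y' := u') (src := src) (D := D)
    hF hDG hDloc hJloc hL hOne
  calc ‖D (M.G src)‖
      ≤ (κ.c1 * A * s₁ + κ.cF * A * s₁ * (κ.cL * A) / (2 * M.γ)) * ν * Real.exp (2 * M.δ₀ * M.c)
          * (1 - 2 * M.γ * M.θ * K)⁻¹ * Real.exp (-(M.δ₀ * dist u u')) * m₁ := key
    _ = _ := by ring

end Dominate

end

end Literature.MathematicalPhysics.QuantumFieldTheory.Balaban1983to89.B5SupWalk131
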